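import Summits.QuantumFields.BalabanUV.Beta.GAN24.SymHessianGaugeLegContact
import Summits.QuantumFields.BalabanUV.Beta.FP.PeriodisedFormGaugeLeg
import Summits.QuantumFields.BalabanUV.Beta.FP.PeriodisedBorderWardContact
import Literature.MathematicalPhysics.QuantumFieldTheory.Balaban1983to89.Beta.BalabanStepJets

/-!
# `BalabanUV.Beta.FP.PeriodisedLamGaugeLeg` — road «FP» (binder row D1), ROUTE T, the (J-a) dictionary's row `a1` at level 0, Λ SECTOR:
# **THE FLUCTUATION-LEG (RIGHT-SLOT) PURE-GAUGE LAW OF THE PERIODISED Λ-STENCIL `SLam N c (symHessFFAt ρ L)` ON A BOX `M = L·M′`**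
# (companion of this lineage's `PeriodisedFormGaugeLeg` — there the cubic WILSON family; here the constraint-Hessian family and its `SLam` superposition)

HONEST DEPENDENCY (page 1, mandatory): continuum YM on T⁴ ⇐ BetaPertH ∧ nine spine estimates (0/9 proved); BetaPertH ⇐ (D1) ∧ (D4) ∧ CAP+tail;
G-an2-4 gates asym, D1 and NE2/3/4.  HONEST FRAMING (cell contract, verbatim): «discharging `BetaPertH` makes Bałaban's UV stability UNCONDITIONAL —
a real constructive-QFT result; it is NOT the continuum limit and NOT the Clay problem.»  ABSOLUTE RULE (cell charter, verbatim): «No internally-minted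
statement may enter as a cited fact. Every hypothesis is either kernel-proved in this package or a verbatim quotation of a PUBLISHED theorem with page
reference. The manuscript(s) under audit are NOT citable for their own disputed steps — they are the thing under adjudication; programme-internal
(2001/route/tribunal) claims are never citable.»

WHY.  leaf-02's level-0 door U21 displays the graded Ward row `a1 : H₁·[D₂|D₁] + H₀·W₁ = 𝔔₀ᵀ·Y₁` with the PINNED first-order form jet
`H₁ = perF F (dper F (S_0 ·))|ff`, `S_0 = Lc⁴•wilsonA + (−Lc⁸∕2)•symVhSAt ρ_c + cΛ•SLam Lc (lamCoeffOf KInv Lc) (symHessFFAt ρ_c Lc)` (this lineage's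
`CombHId1Currency.JsB12CombSh0_S_zero_an1_apply`); `symVhSAt` has no field–field block (`SymAveragingHessianCounts.symVhSAt_inl_inl`), so on the ff block
`H₁` is the Wilson family plus the Λ-stencil.  `PeriodisedFormGaugeLeg` computes the Wilson family against a pure-gauge fluctuation leg; THIS FILE does the
same for the Λ-stencil: per coarse bond (§2), for the superposition with ANY coefficient family summable along the fine-period copies (§3 — the diagonal
periodisation of the stencil IS the stencil of the fine-periodised coefficients `c^per μ y κ′ u := Σ'_m c μ (y + M′∘m) κ′ u`, so gan24-leaf-02's lattice law
`SymHessianGaugeLegContact.tsum_SLam_symHessFFAt_mul_dz` applies verbatim at `c^per`), and unconditionally for Bałaban's `c = lamCoeffOf A N` with `A`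
decaying (§4).  Reading: the law sees the potential at the two endpoints of the leg MINUS the two endpoints of the coarse index bond, weighted by the
first-order (0.4) kernel `symLinKerAt` — like the Wilson half, not an antisymmetric `[D₂|D₁]` contraction; `a1` is a property of the DIRECTION.

CONTENT ([folklore] finite sums, re-indexing and period unfolding BY NAME over OUR typed objects — gan24-leaf-02's `tsum_symHessFFAt_mul_dz`,
`tsum_SLam_symHessFFAt_mul_dz`, `summable_mul_SLam_symHessFFAt`, `SLam_symHessFFAt_*`, `exists_finset_near`; an1-lineage `symHessFFAt_translate`,
`symLinKerAt_eq_zero`; lit `abs_lamCoeffOf_le`; the OWNER lineage's `summable_exp_l1_translate`, `tsum_sites_eq_sum_tsum`; no `def`, no `def … : Prop`,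
nothing cited, 0 sorry):
§1 = `PeriodisedFormGaugeLeg.sum_perZ_mul_grad_periodic_ff` BY NAME (torus ff pairing = lattice pairing, any periodic potential; gen 34: the local copy removed); §2 `dper_symHessFFAt_apply`,
**`sum_perZ_dper_symHessFFAt_mul_grad_periodic`** (one coarse bond); §3 `symHessFFAt_copies`, **`dper_SLam_symHessFFAt`** (`_inl_inl`),
**`sum_perZ_dper_SLam_symHessFFAt_mul_grad_periodic`**; §4 `summable_lamCoeffOf_copies`, **`sum_perZ_dper_SLam_lamCoeffOf_mul_grad_periodic`**; §5 `sum_perZ_dper_SLam_mul_tgrad ∕ _mul_tgradBlock` (the two gauge-mode families of the torus call).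
NOT HERE: the dictionary bridge `Σ'_k symLinKerAt …` ↔ the periodised averaging row `Q₁₀` (row OWNER an2's), the per-direction discharge of `a1`.
Discharges NO binder of row D1 and NO row of the door by itself; 0 estimates; 0∕4 row-D1 binders (hW, hR, D1Tel, D1Rep); NOT (J-a) complete, NOT (T-ID), NOT SDF,
NOT D1, NEVER «G-an2-4 closed», NOT BetaPertH, NOT continuum, NOT Clay.  «not in print; our bookkeeping».
Unit `b2b-balaban-beta-d1-formalise-leaf-05` (gen 33; gen 34 re-based on `PeriodisedFormGaugeLeg`), 2026-08-23; no existing file touched.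
-/

noncomputable section

namespace Summit.QuantumFields.BalabanUV.Beta.FP.PeriodisedLamGaugeLeg

open scoped BigOperators
open Finset
open Literature.MathematicalPhysics.QuantumFieldTheory.Balaban1983to89
open Literature.MathematicalPhysics.QuantumFieldTheory.Balaban1983to89.Beta
open B4TorusKernel.MultiPeriod (translate translate_apply)
open B6Lemma24Torus (pbox mem_pbox)
open ExpKernelCalculus (MKer shiftK)
open AffineAveraging (Site box toSite unitVec dz)
open AveragingHessianKernels (Near)
open OneStepResolventKernel (Fib)
open Summit.QuantumFields.BalabanUV.Beta.SymAveragingHessianCounts (symHessFFAt symHessKerAt symHessFFAt_inl_inl symLinKerAt symHessFFAt_translate symLinKerAt_eq_zero)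
open InterLevelTransport (SLam)
open Summit.QuantumFields.BalabanUV.Beta.LinearGaugeVH (nearBox mem_nearBox summable_of_finsupp)
open Summit.QuantumFields.BalabanUV.Beta.GAN24.HessianGaugeLegContact (exists_finset_near)
open Summit.QuantumFields.BalabanUV.Beta.GAN24.SymHessianGaugeLegContact (tsum_symHessFFAt_mul_dz symHessFFAt_inl_inl_eq_zero_of_not_mem
  symHessFFAt_inl_inl_eq_zero_of_not_mem_right SLam_symHessFFAt_inl_inl SLam_symHessFFAt_inl_inr SLam_symHessFFAt_inr SLam_symHessFFAt_antisymm
  tsum_coeff_mul_symHessKerAt_eq_sum summable_mul_SLam_symHessFFAt tsum_SLam_symHessFFAt_mul_dz)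
open Summit.QuantumFields.BalabanUV.Beta.FP.KernelPeriodisationFib (Idx perF perF_apply perZ perZ_apply)
open Summit.QuantumFields.BalabanUV.Beta.FP.KernelPeriodisationFibLoc (dper dper_apply summable_exp_l1_translate)
open ExpKernelCalculus (Decays)
open BalabanStepJets (lamCoeffOf abs_lamCoeffOf_le)
open Summit.QuantumFields.BalabanUV.Beta.FP.KernelPeriodisationFibTrace (tsum_sites_eq_sum_tsum)
open Summit.QuantumFields.BalabanUV.Beta.FP.PeriodisedFormGaugeLeg (sum_perZ_mul_grad_periodic_ff)

variable {d : ℕ} (M : Fin (d + 1) → ℕ) [∀ μ, NeZero (M μ)]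

/-! ## §1 Torus pairing = lattice pairing, ff block: `PeriodisedFormGaugeLeg.sum_perZ_mul_grad_periodic_ff` (imported BY NAME, not re-proved) -/

/-! ## §2 The coarse-indexed constraint-Hessian family: periodisation = sum over the coarse copies of the index bond -/

variable {M' : Fin (d + 1) → ℕ} {L : ℕ}

omit [∀ μ, NeZero (M μ)] in
/-- [folklore] **`dper` OF A COARSE-INDEXED BLOCK-COVARIANT FAMILY**: for `M = L·M′` (fine period = `L ×` coarse period) and the rooted table
`H_{(μ,y)} = symHessFFAt ρ L μ y` (covariant: `H_{(μ, y+t)} = shiftK (−L•t) H_{(μ,y)}`), `dper M (H_{(μ,y)}) x z a b = Σ'_k H_{(μ, y + M′∘k)} x z a b`. -/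
theorem dper_symHessFFAt_apply (hM : ∀ i, M i = L * M' i) (ρ : Site (d + 1)) (μ : Fin (d + 1)) (y x z : Site (d + 1)) (a b : Fib d) :
    dper M (symHessFFAt ρ L μ y) x z a b = ∑' k : Site (d + 1), symHessFFAt ρ L μ (translate M' y k) x z a b := by
  rw [dper_apply, ← (Equiv.neg (Site (d + 1))).tsum_eq fun k => symHessFFAt ρ L μ (translate M' y k) x z a b]
  refine tsum_congr fun m => ?_
  rw [show translate M' y ((Equiv.neg (Site (d + 1))) m) = y + (fun i => -((M' i : ℤ) * m i)) by
        funext i; simp only [translate_apply, Equiv.neg_apply, Pi.neg_apply, Pi.add_apply]; ring,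
    symHessFFAt_translate]
  simp only [shiftK]
  congr 1 <;> funext i <;> simp only [translate_apply, Pi.add_apply, Pi.neg_apply, Pi.smul_apply, smul_eq_mul, hM i] <;> push_cast <;> ring

/-- [folklore] **THE RIGHT-SLOT PURE-GAUGE LAW OF THE PERIODISED CONSTRAINT-HESSIAN FAMILY, ONE COARSE BOND** (box root `ρ = toSite r`, `r ∈ box L`, `1 ≤ L`, fine box
`M = L·M′`, ANY `Mℤ^{d+1}`-periodic potential `φ`): for the coarse index bond `(μ, y)` and the left leg `(x, α)`,
`Σ_{(w,β)} perZ M (dper M (symHessFFAt ρ L μ y)) x w (inl α) (inl β) · (φ(w + e_β) − φ w)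
  = −((φ x + φ (x + e_α) − φ (L•y + ρ) − φ (L•y + ρ + L•e_μ)) · (Σ'_k symLinKerAt ρ L μ (y + M′∘k) (α, x)) ∕ 2)`
— the potential read at the two endpoints of the left leg MINUS the two endpoints of the coarse bond (from its root), against the period sum of the
(0.4) first-order kernel (the averaging row, up to the dictionary's normalisation — `PeriodisedSymBorderWardContact.tsum_linSym04At_translate_eq`-type bridge not taken here). -/
theorem sum_perZ_dper_symHessFFAt_mul_grad_periodic (hM : ∀ i, M i = L * M' i) (hL : 1 ≤ L) {r : Fin (d + 1) → ℕ} (hr : r ∈ box (d + 1) L)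
    (μ : Fin (d + 1)) (y x : Site (d + 1)) (α : Fin (d + 1)) {φ : Site (d + 1) → ℝ} (hφ : ∀ z m, φ (translate M z m) = φ z) :
    ∑ w : ↥(pbox M), ∑ β : Fin (d + 1), perZ M (dper M (symHessFFAt (toSite r) L μ y)) x (w : Site (d + 1)) (Sum.inl α) (Sum.inl β)
        * (φ ((w : Site (d + 1)) + unitVec β) - φ w)
      = -((φ x + φ (x + unitVec α) - φ ((L : ℤ) • y + toSite r) - φ ((L : ℤ) • y + toSite r + (L : ℤ) • unitVec μ))
          * (∑' k : Site (d + 1), symLinKerAt (toSite r) L μ (translate M' y k) (α, x)) / 2) := by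
  classical
  have hM'0 : ∀ i, (M' i : ℤ) ≠ 0 := fun i h => by
    have := NeZero.ne (M i); rw [hM i] at this
    exact this (by exact_mod_cast (mul_eq_zero.2 (Or.inr (by exact_mod_cast h)) : L * M' i = 0))
  -- the coarse copies of the index bond whose support box contains the left leg `x` are finitely many
  obtain ⟨s, hs⟩ := exists_finset_near (d := d) hL x
  have hinj : Function.Injective fun k : Site (d + 1) => translate M' y k := by
    intro k k' h
    funext i
    have hi := congrFun h i
    simp only [translate_apply] at hi
    exact mul_left_cancel₀ (hM'0 i) (by linarith)
  set F : Finset (Site (d + 1)) := s.preimage (fun k => translate M' y k) hinj.injOn with hF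
  have hF' : ∀ k ∉ F, ¬ Near L (translate M' y k) x := fun k hk hn => hk (Finset.mem_preimage.2 (hs _ hn))
  have hdper : ∀ (z : Site (d + 1)) (β : Fin (d + 1)),
      dper M (symHessFFAt (toSite r) L μ y) x z (Sum.inl α) (Sum.inl β)
        = ∑ k ∈ F, symHessFFAt (toSite r) L μ (translate M' y k) x z (Sum.inl α) (Sum.inl β) := fun z β => by
    rw [dper_symHessFFAt_apply M hM]
    exact tsum_eq_sum fun k hk => symHessFFAt_inl_inl_eq_zero_of_not_mem hr μ _ z α β (fun hx => hF' k hk (mem_nearBox.1 hx))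
  have hK : ∀ (β : Fin (d + 1)) (g : Site (d + 1) → ℝ),
      Summable fun z => dper M (symHessFFAt (toSite r) L μ y) x z (Sum.inl α) (Sum.inl β) * g z := by
    intro β g
    have : (fun z => dper M (symHessFFAt (toSite r) L μ y) x z (Sum.inl α) (Sum.inl β) * g z)
        = fun z => ∑ k ∈ F, symHessFFAt (toSite r) L μ (translate M' y k) x z (Sum.inl α) (Sum.inl β) * g z := by
      funext z; rw [hdper, Finset.sum_mul]
    rw [this]
    refine summable_sum fun k _ => summable_of_finsupp (nearBox L (translate M' y k)) fun z hz => ?_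
    rw [symHessFFAt_inl_inl_eq_zero_of_not_mem_right hr μ _ x α β hz, zero_mul]
  rw [sum_perZ_mul_grad_periodic_ff M _ x α hφ hK]
  have hswap : ∑' z : Site (d + 1), ∑ β : Fin (d + 1), dper M (symHessFFAt (toSite r) L μ y) x z (Sum.inl α) (Sum.inl β) * dz φ β z
      = ∑ k ∈ F, ∑' z : Site (d + 1), ∑ β : Fin (d + 1), symHessFFAt (toSite r) L μ (translate M' y k) x z (Sum.inl α) (Sum.inl β) * dz φ β z := by
    have hsm : ∀ k ∈ F, Summable fun z => ∑ β : Fin (d + 1), symHessFFAt (toSite r) L μ (translate M' y k) x z (Sum.inl α) (Sum.inl β) * dz φ β z :=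
      fun k _ => summable_of_finsupp (nearBox L (translate M' y k)) fun z hz =>
        Finset.sum_eq_zero fun β _ => by rw [symHessFFAt_inl_inl_eq_zero_of_not_mem_right hr μ _ x α β hz, zero_mul]
    rw [← Summable.tsum_finsetSum hsm]
    refine tsum_congr fun z => ?_
    rw [Finset.sum_comm]
    refine Finset.sum_congr rfl fun β _ => ?_
    rw [hdper z β, Finset.sum_mul]
  rw [hswap]
  have hcopy : ∀ k ∈ F, ∑' z : Site (d + 1), ∑ β : Fin (d + 1), symHessFFAt (toSite r) L μ (translate M' y k) x z (Sum.inl α) (Sum.inl β) * dz φ β z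
      = -((φ x + φ (x + unitVec α) - φ ((L : ℤ) • y + toSite r) - φ ((L : ℤ) • y + toSite r + (L : ℤ) • unitVec μ))
          * symLinKerAt (toSite r) L μ (translate M' y k) (α, x) / 2) := fun k _ => by
    rw [tsum_symHessFFAt_mul_dz hL hr μ (translate M' y k) x α φ]
    have h1 : (L : ℤ) • translate M' y k + toSite r = translate M ((L : ℤ) • y + toSite r) k := by
      funext i; simp only [translate_apply, Pi.add_apply, Pi.smul_apply, smul_eq_mul, hM i]; push_cast; ring
    have h2 : (L : ℤ) • translate M' y k + toSite r + (L : ℤ) • unitVec μ = translate M ((L : ℤ) • y + toSite r + (L : ℤ) • unitVec μ) k := by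
      funext i; simp only [translate_apply, Pi.add_apply, Pi.smul_apply, smul_eq_mul, hM i]; push_cast; ring
    rw [h2, h1, hφ, hφ]
  rw [Finset.sum_congr rfl hcopy, Finset.sum_neg_distrib]
  congr 1
  rw [← Finset.sum_div, ← Finset.mul_sum]
  congr 2
  exact (tsum_eq_sum fun k hk => symLinKerAt_eq_zero hr (f := (α, x)) (hF' k hk)).symm


/-! ## §3 The Λ-stencil `SLam N c (symHessFFAt ρ L) κ′ u` (U21's Λ sector, `c = lamCoeffOf KInv Lc`, `N = L = Lc`): its diagonal periodisation
is the SAME stencil with FINE-PERIODISED conversion coefficients `c^per μ y κ′ u := Σ'_m c μ (y + M′∘m) κ′ u`; hence its torus right-slot law is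
gan24-leaf-02's lattice law `tsum_SLam_symHessFFAt_mul_dz` read at `c^per`. -/

section Lambda

variable {N : ℕ} [NeZero N]

omit [∀ μ, NeZero (M μ)] in
/-- [folklore] block covariance read on the period copies: the table of the copy `y + M′∘m` of the coarse bond at the copies `x + M∘m`, `z + M∘m` of the
two fluctuation sites is the table of `y` at `x, z` (`M = L·M′`). -/
theorem symHessFFAt_copies (hM : ∀ i, M i = L * M' i) (ρ : Site (d + 1)) (μ : Fin (d + 1)) (y x z m : Site (d + 1)) (a b : Fib d) :
    symHessFFAt ρ L μ (translate M' y m) (translate M x m) (translate M z m) a b = symHessFFAt ρ L μ y x z a b := by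
  rw [show translate M' y m = y + (fun i => (M' i : ℤ) * m i) by funext i; simp only [translate_apply, Pi.add_apply], symHessFFAt_translate]
  simp only [shiftK]
  congr 1 <;> funext i <;> simp only [translate_apply, Pi.add_apply, Pi.neg_apply, Pi.smul_apply, smul_eq_mul, hM i] <;> push_cast <;> ring

omit [∀ μ, NeZero (M μ)] in
/-- [folklore] **THE DIAGONAL PERIODISATION OF THE Λ-STENCIL = THE Λ-STENCIL OF THE FINE-PERIODISED COEFFICIENTS**, field–field block
(box root; `M = L·M′`; coefficients summable along the fine-period copies of each coarse bond):
`dper M (SLam N c (symHessFFAt ρ L) κ′ u) x z (inl α) (inl α′) = SLam N c^per (symHessFFAt ρ L) κ′ u x z (inl α) (inl α′)`. -/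
theorem dper_SLam_symHessFFAt_inl_inl (hM : ∀ i, M i = L * M' i) (hL : 1 ≤ L) {r : Fin (d + 1) → ℕ} (hr : r ∈ box (d + 1) L)
    (c : Fin (d + 1) → Site (d + 1) → Fin (d + 1) → Site (d + 1) → ℝ) (κ' : Fin (d + 1)) (u : Site (d + 1))
    (hc : ∀ μ y, Summable fun m : Site (d + 1) => c μ (translate M' y m) κ' u) (x z : Site (d + 1)) (α α' : Fin (d + 1)) :
    dper M (SLam N c (fun μ y => symHessFFAt (toSite r) L μ y) κ' u) x z (Sum.inl α) (Sum.inl α')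
      = SLam N (fun μ y κ'' u' => ∑' m : Site (d + 1), c μ (translate M' y m) κ'' u') (fun μ y => symHessFFAt (toSite r) L μ y) κ' u x z
          (Sum.inl α) (Sum.inl α') := by
  classical
  obtain ⟨s, hs⟩ := exists_finset_near (d := d) hL z
  have hfin : ∀ (w : Site (d + 1) → ℝ) (μ : Fin (d + 1)),
      ∑' y, w y * symHessKerAt (toSite r) L μ y (α, x) (α', z) = ∑ y ∈ s, w y * symHessKerAt (toSite r) L μ y (α, x) (α', z) :=
    fun w μ => tsum_coeff_mul_symHessKerAt_eq_sum hr hs w μ (α, x) α'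
  have hker : ∀ (μ : Fin (d + 1)) (y' m : Site (d + 1)),
      symHessKerAt (toSite r) L μ (translate M' y' m) (α, translate M x m) (α', translate M z m) = symHessKerAt (toSite r) L μ y' (α, x) (α', z) :=
    fun μ y' m => by
      have h := symHessFFAt_copies M hM (toSite r) μ y' x z m (Sum.inl α) (Sum.inl α')
      simpa only [symHessFFAt_inl_inl] using h
  have hm : ∀ m : Site (d + 1),
      SLam N c (fun μ y => symHessFFAt (toSite r) L μ y) κ' u (translate M x m) (translate M z m) (Sum.inl α) (Sum.inl α')
        = -∑ μ : Fin (d + 1), ∑ y ∈ s, c μ (translate M' y m) κ' u * symHessKerAt (toSite r) L μ y (α, x) (α', z) := by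
    intro m
    rw [SLam_symHessFFAt_inl_inl]
    congr 1
    refine Finset.sum_congr rfl fun μ _ => ?_
    set v : Site (d + 1) := fun i => (M' i : ℤ) * m i with hv
    have htr : ∀ y' : Site (d + 1), y' + v = translate M' y' m := fun y' => by
      funext i; simp only [translate_apply, hv, Pi.add_apply]
    rw [← (Equiv.addRight v).tsum_eq (fun y => c μ y κ' u * symHessKerAt (toSite r) L μ y (α, translate M x m) (α', translate M z m))]
    simp only [Equiv.coe_addRight, htr, hker]
    exact hfin _ μ
  rw [dper_apply, tsum_congr hm, tsum_neg, SLam_symHessFFAt_inl_inl]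
  congr 1
  simp only [hfin]
  rw [Summable.tsum_finsetSum (fun μ _ => summable_sum fun y _ => (hc μ y).mul_right _)]
  refine Finset.sum_congr rfl fun μ _ => ?_
  rw [Summable.tsum_finsetSum (fun y _ => (hc μ y).mul_right _)]
  exact Finset.sum_congr rfl fun y _ => tsum_mul_right

omit [∀ μ, NeZero (M μ)] in
/-- [folklore] the same identity as an equality of KERNELS (the other blocks of both sides vanish). -/
theorem dper_SLam_symHessFFAt (hM : ∀ i, M i = L * M' i) (hL : 1 ≤ L) {r : Fin (d + 1) → ℕ} (hr : r ∈ box (d + 1) L)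
    (c : Fin (d + 1) → Site (d + 1) → Fin (d + 1) → Site (d + 1) → ℝ) (κ' : Fin (d + 1)) (u : Site (d + 1))
    (hc : ∀ μ y, Summable fun m : Site (d + 1) => c μ (translate M' y m) κ' u) :
    dper M (SLam N c (fun μ y => symHessFFAt (toSite r) L μ y) κ' u)
      = SLam N (fun μ y κ'' u' => ∑' m : Site (d + 1), c μ (translate M' y m) κ'' u') (fun μ y => symHessFFAt (toSite r) L μ y) κ' u := by
  funext x z a b
  rcases a with α | ν <;> rcases b with α' | ν'
  · exact dper_SLam_symHessFFAt_inl_inl M hM hL hr c κ' u hc x z α α'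
  all_goals simp only [dper_apply, SLam_symHessFFAt_inl_inr, SLam_symHessFFAt_inr, tsum_zero]

/-- [folklore] **THE RIGHT-SLOT PURE-GAUGE LAW OF THE PERIODISED Λ-STENCIL** (box root `ρ = toSite r`, `M = L·M′`, ANY coefficient family `c` summable
along the fine-period copies, ANY `Mℤ^{d+1}`-periodic `φ`):
`Σ_{(w,β)} perZ M (dper M (SΛ κ′ u)) x w (inl α) (inl β) · (φ(w + e_β) − φ w)
  = Σ_μ Σ'_y c^per μ y κ′ u · (φ x + φ(x + e_α) − φ(L•y + ρ) − φ(L•y + ρ + L•e_μ)) · q¹_{(μ,y)}(α, x) ∕ 2`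
— leg endpoints minus coarse-bond endpoints, weighted by the first-order (0.4) kernel and the PERIODISED conversion coefficients. -/
theorem sum_perZ_dper_SLam_symHessFFAt_mul_grad_periodic (hM : ∀ i, M i = L * M' i) (hL : 1 ≤ L) {r : Fin (d + 1) → ℕ}
    (hr : r ∈ box (d + 1) L) (c : Fin (d + 1) → Site (d + 1) → Fin (d + 1) → Site (d + 1) → ℝ) (κ' : Fin (d + 1)) (u : Site (d + 1))
    (hc : ∀ μ y, Summable fun m : Site (d + 1) => c μ (translate M' y m) κ' u) (x : Site (d + 1)) (α : Fin (d + 1))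
    {φ : Site (d + 1) → ℝ} (hφ : ∀ z m, φ (translate M z m) = φ z) :
    ∑ w : ↥(pbox M), ∑ β : Fin (d + 1),
        perZ M (dper M (SLam N c (fun μ y => symHessFFAt (toSite r) L μ y) κ' u)) x (w : Site (d + 1)) (Sum.inl α) (Sum.inl β)
          * (φ ((w : Site (d + 1)) + unitVec β) - φ w)
      = ∑ μ : Fin (d + 1), ∑' y : Site (d + 1), (∑' m : Site (d + 1), c μ (translate M' y m) κ' u) *
          ((φ x + φ (x + unitVec α) - φ ((L : ℤ) • y + toSite r) - φ ((L : ℤ) • y + toSite r + (L : ℤ) • unitVec μ))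
            * symLinKerAt (toSite r) L μ y (α, x) / 2) := by
  set cper : Fin (d + 1) → Site (d + 1) → Fin (d + 1) → Site (d + 1) → ℝ := fun μ y κ'' u' => ∑' m : Site (d + 1), c μ (translate M' y m) κ'' u'
    with hcper
  have hK : ∀ (β : Fin (d + 1)) (g : Site (d + 1) → ℝ),
      Summable fun z => SLam N cper (fun μ y => symHessFFAt (toSite r) L μ y) κ' u x z (Sum.inl α) (Sum.inl β) * g z := by
    intro β g
    have h : (fun z => SLam N cper (fun μ y => symHessFFAt (toSite r) L μ y) κ' u x z (Sum.inl α) (Sum.inl β) * g z)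
        = fun z => -(g z * SLam N cper (fun μ y => symHessFFAt (toSite r) L μ y) κ' u z x (Sum.inl β) (Sum.inl α)) := by
      funext z
      rw [SLam_symHessFFAt_antisymm (toSite r) L cper κ' u z x (Sum.inl β) (Sum.inl α)]
      ring
    rw [h]
    exact (summable_mul_SLam_symHessFFAt hL hr cper κ' u x β α g).neg
  rw [dper_SLam_symHessFFAt M hM hL hr c κ' u hc, sum_perZ_mul_grad_periodic_ff M _ x α hφ hK]
  exact tsum_SLam_symHessFFAt_mul_dz hL hr cper κ' u x α φ

end Lambda


/-! ## §4 `hc` DISCHARGED for Bałaban's coefficients `c = lamCoeffOf A N` (`Decays A C δ`, `δ > 0`; at the record `A = KInv`, lit `decays_KInv`) -/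

section Record

variable {N : ℕ} [NeZero N]

omit [NeZero N] in
/-- [folklore] **THE CONVERSION COEFFICIENTS ARE SUMMABLE ALONG THE FINE-PERIOD COPIES OF EACH COARSE BOND** (`M = N·M′`): from lit-balaban's decay letter
`abs_lamCoeffOf_le` (`|c μ y κ′ u| ≤ C′·e^{−δ|N•y − u|₁}`) and the lattice sum `summable_exp_l1_translate` (`N•(y + M′∘m) = N•y + M∘m`). -/
theorem summable_lamCoeffOf_copies {A : MKer (d + 1) (Fib d)} {C δ : ℝ} (hA : Decays A C δ) (hC : 0 ≤ C) (hδ : 0 < δ)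
    (hM : ∀ i, M i = N * M' i) (μ : Fin (d + 1)) (y : Site (d + 1)) (κ' : Fin (d + 1)) (u : Site (d + 1)) :
    Summable fun m : Site (d + 1) => lamCoeffOf A N μ (translate M' y m) κ' u := by
  have hs := (summable_exp_l1_translate M hδ u ((N : ℤ) • y)).1.mul_left
    ((3 : ℝ) ^ (d + 1) * ((d + 1 : ℕ) : ℝ) * (16 * ((d + 1 : ℕ) : ℝ)) * C * Real.exp (((d + 1 : ℕ) : ℝ) * δ))
  refine hs.of_norm_bounded fun m => ?_
  rw [Real.norm_eq_abs]
  have h := abs_lamCoeffOf_le (N := N) hA hC hδ.le μ (translate M' y m) κ' u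
  have e : (N : ℤ) • translate M' y m - u = translate M ((N : ℤ) • y) m - u := by
    funext i; simp only [Pi.sub_apply, Pi.smul_apply, translate_apply, smul_eq_mul, hM i]; push_cast; ring
  rw [e] at h
  exact h

/-- [folklore] **THE TORUS RIGHT-SLOT LAW OF THE Λ SECTOR AT BAŁABAN's COEFFICIENTS, NO `hc` BINDER** (box root, `M = N·M′ = L·M′` — at U21's record `N = L = Lc`; `Decays A C δ`, `δ > 0`):
`Σ_{(w,β)} perZ M (dper M (SLam N (lamCoeffOf A N) (symHessFFAt ρ L) κ′ u)) x w (inl α) (inl β) · (φ(w + e_β) − φ w)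
  = Σ_μ Σ'_y (Σ'_m lamCoeffOf A N μ (y + M′∘m) κ′ u) · (φ x + φ(x + e_α) − φ(L•y + ρ) − φ(L•y + ρ + L•e_μ)) · q¹_{(μ,y)}(α, x) ∕ 2`. -/
theorem sum_perZ_dper_SLam_lamCoeffOf_mul_grad_periodic {A : MKer (d + 1) (Fib d)} {C δ : ℝ} (hA : Decays A C δ) (hC : 0 ≤ C) (hδ : 0 < δ)
    (hM : ∀ i, M i = N * M' i) (hML : ∀ i, M i = L * M' i) (hL : 1 ≤ L) {r : Fin (d + 1) → ℕ} (hr : r ∈ box (d + 1) L)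
    (κ' : Fin (d + 1)) (u x : Site (d + 1)) (α : Fin (d + 1)) {φ : Site (d + 1) → ℝ} (hφ : ∀ z m, φ (translate M z m) = φ z) :
    ∑ w : ↥(pbox M), ∑ β : Fin (d + 1),
        perZ M (dper M (SLam N (lamCoeffOf A N) (fun μ y => symHessFFAt (toSite r) L μ y) κ' u)) x (w : Site (d + 1)) (Sum.inl α) (Sum.inl β)
          * (φ ((w : Site (d + 1)) + unitVec β) - φ w)
      = ∑ μ : Fin (d + 1), ∑' y : Site (d + 1), (∑' m : Site (d + 1), lamCoeffOf A N μ (translate M' y m) κ' u) *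
          ((φ x + φ (x + unitVec α) - φ ((L : ℤ) • y + toSite r) - φ ((L : ℤ) • y + toSite r + (L : ℤ) • unitVec μ))
            * symLinKerAt (toSite r) L μ y (α, x) / 2) :=
  sum_perZ_dper_SLam_symHessFFAt_mul_grad_periodic M hML hL hr (lamCoeffOf A N) κ' u
    (fun μ y => summable_lamCoeffOf_copies M hA hC hδ hM μ y κ' u) x α hφ

end Record


/-! ## §5 The two gauge-mode families of the torus call on `F = fine Lc M′`: fine modes `tgrad F` (potential `tdelta F · s`) and block-constant modes
`tgradBlock M′ Lc` (potential `tdelta M′ (quo Lc ·) t`) — §3 at these two periodic potentials (gen 34: moved here from the door file) -/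

section Modes

open Summit.QuantumFields.BalabanUV.Beta.FP.TorusGaugeCovariance (tdelta tdelta_translate tgrad tgrad_inl)
open Summit.QuantumFields.BalabanUV.Beta.FP.TorusGaugeCovarianceCoarse (tgradBlock tgradBlock_inl tdelta_quo_congr)
open Literature.MathematicalPhysics.QuantumFieldTheory.LatticeForm (quo)
open B5Prop11Plancherel (fine)

variable (M' : Fin (d + 1) → ℕ) [∀ μ, NeZero (M' μ)] (Lc : ℕ) [NeZero Lc]

/-- **J15-t** — the Λ-stencil against a FINE gauge-mode column `s` of `tgrad F`. -/
theorem sum_perZ_dper_SLam_mul_tgrad {r : Fin (d + 1) → ℕ} (hr : r ∈ box (d + 1) Lc)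
    (c : Fin (d + 1) → Site (d + 1) → Fin (d + 1) → Site (d + 1) → ℝ) (κ' : Fin (d + 1)) (u : Site (d + 1))
    (hc : ∀ μ y, Summable fun m : Site (d + 1) => c μ (translate M' y m) κ' u) (x : Site (d + 1)) (α : Fin (d + 1)) (s : ↥(pbox (fine Lc M'))) :
    ∑ w : ↥(pbox (fine Lc M')), ∑ β : Fin (d + 1),
        perZ (fine Lc M') (dper (fine Lc M') (SLam Lc c (fun μ y => symHessFFAt (toSite r) Lc μ y) κ' u)) x (w : Site (d + 1)) (Sum.inl α) (Sum.inl β)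
          * tgrad (fine Lc M') (w, Sum.inl β) s
      = ∑ μ : Fin (d + 1), ∑' y : Site (d + 1), (∑' m : Site (d + 1), c μ (translate M' y m) κ' u) *
          ((tdelta (fine Lc M') x s + tdelta (fine Lc M') (x + unitVec α) s - tdelta (fine Lc M') ((Lc : ℤ) • y + toSite r) s
              - tdelta (fine Lc M') ((Lc : ℤ) • y + toSite r + (Lc : ℤ) • unitVec μ) s)
            * symLinKerAt (toSite r) Lc μ y (α, x) / 2) := by
  have h := sum_perZ_dper_SLam_symHessFFAt_mul_grad_periodic (fine Lc M') (M' := M') (L := Lc) (N := Lc) (fun _ => rfl)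
    (Nat.one_le_iff_ne_zero.mpr (NeZero.ne Lc)) hr c κ' u hc x α (φ := fun z => tdelta (fine Lc M') z s) (fun z m => tdelta_translate (fine Lc M') z m s)
  simpa only [tgrad_inl] using h

/-- **J15-b** — the Λ-stencil against a BLOCK-CONSTANT gauge-mode column `t` of `tgradBlock M′ Lc`. -/
theorem sum_perZ_dper_SLam_mul_tgradBlock {r : Fin (d + 1) → ℕ} (hr : r ∈ box (d + 1) Lc)
    (c : Fin (d + 1) → Site (d + 1) → Fin (d + 1) → Site (d + 1) → ℝ) (κ' : Fin (d + 1)) (u : Site (d + 1))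
    (hc : ∀ μ y, Summable fun m : Site (d + 1) => c μ (translate M' y m) κ' u) (x : Site (d + 1)) (α : Fin (d + 1)) (t : ↥(pbox M')) :
    ∑ w : ↥(pbox (fine Lc M')), ∑ β : Fin (d + 1),
        perZ (fine Lc M') (dper (fine Lc M') (SLam Lc c (fun μ y => symHessFFAt (toSite r) Lc μ y) κ' u)) x (w : Site (d + 1)) (Sum.inl α) (Sum.inl β)
          * tgradBlock M' Lc (w, Sum.inl β) t
      = ∑ μ : Fin (d + 1), ∑' y : Site (d + 1), (∑' m : Site (d + 1), c μ (translate M' y m) κ' u) *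
          ((tdelta M' (quo Lc x) t + tdelta M' (quo Lc (x + unitVec α)) t - tdelta M' (quo Lc ((Lc : ℤ) • y + toSite r)) t
              - tdelta M' (quo Lc ((Lc : ℤ) • y + toSite r + (Lc : ℤ) • unitVec μ)) t)
            * symLinKerAt (toSite r) Lc μ y (α, x) / 2) := by
  have hφ : ∀ z m : Site (d + 1), tdelta M' (quo Lc (translate (fine Lc M') z m)) t = tdelta M' (quo Lc z) t := fun z m => by
    refine tdelta_quo_congr M' Lc (fun i => ⟨m i, ?_⟩) t
    simp only [translate_apply, fine]
    push_cast
    ring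
  have h := sum_perZ_dper_SLam_symHessFFAt_mul_grad_periodic (fine Lc M') (M' := M') (L := Lc) (N := Lc) (fun _ => rfl)
    (Nat.one_le_iff_ne_zero.mpr (NeZero.ne Lc)) hr c κ' u hc x α (φ := fun z => tdelta M' (quo Lc z) t) hφ
  simpa only [tgradBlock_inl] using h

end Modes

end Summit.QuantumFields.BalabanUV.Beta.FP.PeriodisedLamGaugeLeg

end
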